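import Summits.SmoothPoincare4.SmoothPoincare4.Theorems.DottedCircleRasmussenDcrGapHelperFriendsPi1G1
import Summits.SmoothPoincare4.SmoothPoincare4.Theorems.DottedCircleRasmussenDcrGapHelperFriendsPi1G2
import Summits.SmoothPoincare4.SmoothPoincare4.Theorems.DottedCircleRasmussenDcrGapHelperFriendsPi1G3
import Summits.SmoothPoincare4.SmoothPoincare4.Theorems.DottedCircleRasmussenDcrGapStubFriendsPi1Assembly

/-!
# Stub `stub_friendsPi1` of line `mk_friends` (skeleton v3) for crux `DcrGap`
(item stmt-SmoothPoincare4-16128, route route-SmoothPoincare4-DottedCircleRasmussen)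

Stub B of the line: the friends-swap carrier `X` — a closed `4`-manifold written as
`X = j(E) ⊔ (i(D_k) ∪ f₀(𝔻²)) ⊔ {q}` with `E = ℝ⁴ ∖ (D_k ∪ Δ₁)` the model disc exterior, `j : E ↪ X` a
smooth open embedding, `q = j(∞)`, `i` a germ chart of the model dotted handlebody `D_k` and `f₀` the
core disc of the `2`-handle attached along `K₀` — is simply connected as soon as the pushed tube
meridian `ℓ = j ∘ m` of the model slice disc `Δ₁ = f₁(𝔻²)` dies in `X`.

The proof is pure logic over the three sub-goals of the line, all accepted in the tree:

* `helper_friendsPi1_G1` — `ℝ⁴ ∖ D_k` is simply connected;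
* `helper_friendsPi1_G2` — Kervaire's lemma for the model disc exterior with its trivialised tube:
  under any continuous `ψ : E → Z` killing the tube meridian, every loop of `E` dies in `Z`;
* `helper_friendsPi1_G3` — every loop of `X` based off the core `C = i(D_k) ∪ f₀(𝔻²)` is homotopic
  to a loop off `C`,

combined by the assembly `helper_friendsPi1_of_G123 : G1 → G2 → G3 → B`
(`…DcrGapStubFriendsPi1Assembly.lean`: `X` is path connected; a loop at `j(a₀)` is pushed off `C`,
then off the point `q`, lifted through the embedding `j` and killed by `G2` applied to `ψ = j`).

No definitions, no named facts, no `sorry`.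
-/

-- the prescribed namespace `Summit.<P>.<Sub>.…` duplicates `SmoothPoincare4` (P = Sub)
set_option linter.dupNamespace false
set_option linter.style.longLine false

noncomputable section

open scoped Manifold ContDiff Topology
open Function Set
open Literature.Topology.FourManifolds Literature.Topology.FourManifolds.MMSW

namespace Summit.SmoothPoincare4.SmoothPoincare4.Theorems.DcrGap.MkFriends

/-- **Stub B of line `mk_friends`: the friends-swap carrier is simply connected once the pushed tube
meridian dies** (see the module docstring; assembled from the sub-goals `G1`, `G2`, `G3` by
`helper_friendsPi1_of_G123`). [cite: ManolescuPiccirillo2023, §3.2, proof of Lemma 3.3] -/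
theorem stub_friendsPi1 : ∀ (k : ℕ) (K₀ K₁ : (Metric.sphere (0 : EuclideanSpace ℝ (Fin 2)) 1) → EuclideanSpace ℝ (Fin 4)) (f₁ : EuclideanSpace ℝ (Fin 2) → EuclideanSpace ℝ (Fin 4)) (T : EuclideanSpace ℝ (Fin 2) × EuclideanSpace ℝ (Fin 2) → EuclideanSpace ℝ (Fin 4)), Literature.Topology.FourManifolds.MMSW.IsModelKnot k K₀ → Literature.Topology.FourManifolds.MMSW.IsModelKnot k K₁ → Literature.Topology.FourManifolds.MMSW.IsModelSliceDisc k K₁ f₁ → (ContDiffOn ℝ ((⊤ : ℕ∞) : WithTop ℕ∞) T (Metric.ball (0 : EuclideanSpace ℝ (Fin 2)) 1 ×ˢ Metric.ball (0 : EuclideanSpace ℝ (Fin 2)) 2) ∧ Set.InjOn T (Metric.ball (0 : EuclideanSpace ℝ (Fin 2)) 1 ×ˢ Metric.ball (0 : EuclideanSpace ℝ (Fin 2)) 2) ∧ (∀ q ∈ Metric.ball (0 : EuclideanSpace ℝ (Fin 2)) 1 ×ˢ Metric.ball (0 : EuclideanSpace ℝ (Fin 2)) 2, Function.Injective (fderiv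 ℝ T q)) ∧ (∀ q ∈ Metric.ball (0 : EuclideanSpace ℝ (Fin 2)) 1 ×ˢ Metric.ball (0 : EuclideanSpace ℝ (Fin 2)) 2, T q ∉ Literature.Topology.FourManifolds.MMSW.modelHandlebody k) ∧ (∀ x ∈ Metric.ball (0 : EuclideanSpace ℝ (Fin 2)) 1, T (x, 0) = f₁ x)) → ∀ (X : Type) [TopologicalSpace X] [T2Space X] [SecondCountableTopology X] [ChartedSpace (EuclideanSpace ℝ (Fin 4)) X] [IsManifold (𝓡 4) ((⊤ : ℕ∞) : WithTop ℕ∞) X] [CompactSpace X] (U : Set (EuclideanSpace ℝ (Fin 4))) (i : EuclideanSpace ℝ (Fin 4) → X) (f₀ : EuclideanSpace ℝ (Fin 2) → X) (g₀ : EuclideanSpace ℝ (Fin 2) → EuclideanSpace ℝ (Fin 4)) (E : TopologicalSpace.Opens (EuclideanSpace ℝ (Fin 4))) (j : E → X) (q : X) (m : (Metric.sphere (0 : EuclideanSpace ℝ (Fin 2)) 1) → EuclideanSpace ℝ (Fin 4)) (ℓ : C((Metric.sphere (0 : EuclideanSpace ℝ (Fin 2)) 1), X)), (IsOpen U ∧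 Literature.Topology.FourManifolds.MMSW.modelHandlebody k ⊆ U ∧ ContMDiffOn (𝓡 4) (𝓡 4) ((⊤ : ℕ∞) : WithTop ℕ∞) i U ∧ Set.InjOn i U ∧ (∀ x ∈ U, Function.Injective (mfderiv (𝓡 4) (𝓡 4) i x))) → (ContMDiff (𝓡 2) (𝓡 4) ((⊤ : ℕ∞) : WithTop ℕ∞) f₀ ∧ Set.InjOn f₀ (Metric.closedBall (0 : EuclideanSpace ℝ (Fin 2)) 1) ∧ (∀ x ∈ Metric.closedBall (0 : EuclideanSpace ℝ (Fin 2)) 1, Function.Injective (mfderiv (𝓡 2) (𝓡 4) f₀ x)) ∧ (∀ x : EuclideanSpace ℝ (Fin 2), ‖x‖ < 1 → f₀ x ∉ i '' Literature.Topology.FourManifolds.MMSW.modelHandlebody k) ∧ (∀ t : (Metric.sphere (0 : EuclideanSpace ℝ (Fin 2)) 1), f₀ t = i (K₀ t)) ∧ ContDiff ℝ ((⊤ : ℕ∞) : WithTop ℕ∞) g₀ ∧ (∃ η : ℝ, 0 < η ∧ (∀ x : EuclideanSpace ℝ (Fin 2), 1 - η < ‖x‖ → ‖x‖ ≤ 1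 → g₀ x ∈ U ∧ f₀ x = i (g₀ x))) ∧ (∀ t : (Metric.sphere (0 : EuclideanSpace ℝ (Fin 2)) 1), deriv (fun ρ : ℝ => Literature.Topology.FourManifolds.MMSW.levelFun k (g₀ (ρ • (t : EuclideanSpace ℝ (Fin 2))))) 1 < 0)) → (((E : Set (EuclideanSpace ℝ (Fin 4))) = {x | x ∉ Literature.Topology.FourManifolds.MMSW.modelHandlebody k ∧ x ∉ f₁ '' Metric.closedBall (0 : EuclideanSpace ℝ (Fin 2)) 1}) ∧ Manifold.IsSmoothEmbedding (𝓡 4) (𝓡 4) ((⊤ : ℕ∞) : WithTop ℕ∞) j ∧ IsOpen (Set.range j) ∧ Set.range j = (i '' Literature.Topology.FourManifolds.MMSW.modelHandlebody k ∪ f₀ '' Metric.closedBall (0 : EuclideanSpace ℝ (Fin 2)) 1 ∪ {q})ᶜ ∧ (∀ s ∈ nhds q, ∃ R : ℝ, ∀ a : E, R < ‖(a : EuclideanSpace ℝ (Fin 4))‖ → j a ∈ s)) → (∀ v : (Metric.sphere (0 : EuclideanSpace ℝ (Fin 2)) 1), m v = T ((0 : EuclideanSpace ℝ (Fin 2)),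 (1 / 2 : ℝ) • (v : EuclideanSpace ℝ (Fin 2)))) → (∀ (v : (Metric.sphere (0 : EuclideanSpace ℝ (Fin 2)) 1)) (a : E), (a : EuclideanSpace ℝ (Fin 4)) = m v → ℓ v = j a) → (∃ x₀ : X, ℓ.Homotopic (ContinuousMap.const (Metric.sphere (0 : EuclideanSpace ℝ (Fin 2)) 1) x₀)) → SimplyConnectedSpace X :=
  helper_friendsPi1_of_G123 helper_friendsPi1_G1 helper_friendsPi1_G2 helper_friendsPi1_G3

end Summit.SmoothPoincare4.SmoothPoincare4.Theorems.DcrGap.MkFriends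

end
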